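import Literature.MathematicalPhysics.QuantumFieldTheory.ConstructiveQFTWave0WilsonLoopOddProofs
import HarnessLib

/-!
# Crux `IR` (stmt-QuantumFields-19354), line `tension-ratio`: Gram inequalities for Wilson loops in an ARBITRARY
# representation `π` on the ODD torus (reflection positivity of the `ρ`-Wilson state, mixed site/link reflection)

Helper module for item `stmt-QuantumFields-19354` (`--supports … --as helper`; it closes nothing).  The tree has the torus Gram
inequalities for rectangular Wilson loops (i) in the action's representation `ρ` on EVEN tori (`ConstructiveQFTWave0WilsonLoopRPProofs`),
(ii) in an arbitrary continuous representation `π` on EVEN tori (`TorusWilsonLoopRepGramBounds`, p592927), (iii) in the representation `ρ` on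
ODD tori (`ConstructiveQFTWave0WilsonLoopOddProofs`: the reflection `θ t = 1 − t` of the odd torus fixes one hyperplane between time slices and
one through sites).  This file supplies the missing fourth corner — **`π`-loops on ODD tori** — by running (iii)'s two proofs with the loop's
representation replaced by `π` (the measure-side primitives `wilsonExpectation_nonneg_of_oddCovariant` ∕ `wilsonExpectation_oddReflectionPositive`
are statements about the `ρ`-state and hold for every bounded observable of the positive half; the loop's representation only enters the
staple algebra `WilsonLoopOddRP.trace_rectangleHolonomy_translateLow` ∕ `hangStaple_timeReflect`, which are representation-generic):

* `wilsonExpectation_gramRep_link_nonneg_odd`, `re_wilsonExpectation_gramRep_hang_nonneg_odd` (complex forms),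
* `re_wilsonExpectation_gramRep_base` (real parts = Gram sums of the real `π`-loop expectations at the origin),
* `gram_wilsonLoopRep_nonneg_odd_of_odd` (heights `a+b+1`, `a+1 ≤ L/2`, `β ≥ 0`) and `gram_wilsonLoopRep_nonneg_even_of_odd`
  (heights `a+b`, `a ≤ L/2`, `β ≥ 0`): the two Hankel matrices of `h ↦ ⟨W^π_{h×R}⟩_{Λ_L,β}` are positive semi-definite, `L` odd, `L ≥ 3`.

Used by `TorusWilsonLoopRepOddPlaquetteBound.lean` (Seiler–Bachas `⟨W^π_{1×1}⟩^{hR} ≤ ⟨W^π_{h×R}⟩` on odd tori) and the reduction of the line's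
`LoopFloorSC` to the `π`-plaquette floor.  HONEST FRAMING: reflection-positivity bookkeeping on finite tori; nothing about `β → ∞`, confinement or the
YM mass gap (Clay, NOT proved); `R4` closes only the conditional rung `BalabanLadder.UV`.
Refs: K. Osterwalder, E. Seiler, Ann. Phys. 110 (1978) 440 §2; E. Seiler, LNP 159 (1982) §2; C. Bachas, Phys. Rev. D 33 (1986) 2723.
-/

set_option autoImplicit false

open MeasureTheory Finset Complex
open scoped ComplexOrder ComplexConjugate

noncomputable section

namespace Summit.QuantumFields.YangMills.Cruxes.IR.OddTorusRP

open Literature.MathematicalPhysics.QuantumFieldTheory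
open WilsonRP WilsonOddRP WilsonLoopRP WilsonLoopOddRP
open Literature.RepresentationTheory.CompactGroups

section Gram

variable {d L N M : ℕ} [NeZero d] [NeZero L] [Fact (1 < L)]
variable {G : Type*} [Group G] [TopologicalSpace G] [IsTopologicalGroup G] [CompactSpace G]
  [MeasurableSpace G] [BorelSpace G]
variable (ρ : G →* Matrix (Fin N) (Fin N) ℂ) (π : G →* Matrix (Fin M) (Fin M) ℂ)

omit [NeZero d] [NeZero L] [Fact (1 < L)] in
/-- Rearranging a Gram double sum of matrix entries. -/
theorem sum_sum_mul_sum_sum_rep {α : Type*} [Fintype α] (S : Finset ℕ) (f g : ℕ → α → α → ℂ) :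
    ∑ i : α, ∑ l : α, (∑ a ∈ S, f a i l) * (∑ b ∈ S, g b i l) =
      ∑ a ∈ S, ∑ b ∈ S, ∑ i : α, ∑ l : α, f a i l * g b i l := by
  simp only [Finset.sum_mul_sum]
  calc ∑ i : α, ∑ l : α, ∑ a ∈ S, ∑ b ∈ S, f a i l * g b i l
      = ∑ i : α, ∑ a ∈ S, ∑ l : α, ∑ b ∈ S, f a i l * g b i l :=
        Finset.sum_congr rfl fun i _ => Finset.sum_comm
    _ = ∑ a ∈ S, ∑ i : α, ∑ l : α, ∑ b ∈ S, f a i l * g b i l := Finset.sum_comm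
    _ = ∑ a ∈ S, ∑ i : α, ∑ b ∈ S, ∑ l : α, f a i l * g b i l :=
        Finset.sum_congr rfl fun a _ => Finset.sum_congr rfl fun i _ => Finset.sum_comm
    _ = ∑ a ∈ S, ∑ b ∈ S, ∑ i : α, ∑ l : α, f a i l * g b i l :=
        Finset.sum_congr rfl fun a _ => Finset.sum_comm

/-! ## §1 Link hyperplane: Gram positivity for `π`-rectangles of odd height on the odd torus (complex form) -/

/-- **Gram positivity for link-bisected `π`-rectangles on the odd torus** (complex form): for `L` odd, `L ≥ 3`, `β ≥ 0`, heights `a + 1 ≤ L/2`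
and real coefficients, `0 ≤ ⟨∑_{a,b} c_a c_b tr σ_π(W_{(a+b+1) × R} based at (−b, 0⃗))⟩_{Λ_L,β}` under the torus Wilson state of `ρ`
(`wilsonExpectation_nonneg_of_oddCovariant` applied to the covariant `π`-words). -/
theorem wilsonExpectation_gramRep_link_nonneg_odd (hL : Odd L) (hL3 : 3 ≤ L) (hρ : Continuous ρ) {β : ℝ}
    (hβ : 0 ≤ β) (hπ : Continuous π) {j : Fin d} (hj : j ≠ 0) (R : ℕ) (S : Finset ℕ) (hS : ∀ a ∈ S, a + 1 ≤ L / 2)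
    (c : ℕ → ℝ) :
    0 ≤ wilsonExpectation ρ β fun U : GaugeConfig d L G => ∑ a ∈ S, ∑ b ∈ S, (c a * c b : ℂ) *
      (CompactGroup.unitarize π hπ (rectangleHolonomy U (tBase b) 0 j (a + b + 1) R)).trace := by
  set σ := CompactGroup.unitarize π hπ with hσdef
  refine wilsonExpectation_nonneg_of_oddCovariant ρ hL hL3 hρ hβ (K := Fin M × Fin M)
    (g := fun il V => ∑ a ∈ S, (c a : ℂ) * σ (linkWord j R a V) il.1 il.2)
    (fun il => Finset.measurable_sum _ fun a _ =>
      (entryMeasurable_linkWord π hπ j R a il.1 il.2).const_mul _)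
    (Kg := ∑ a ∈ S, ‖(c a : ℂ)‖) (fun il V => ?_) (fun il => ?_) ?_ ?_
  · refine (norm_sum_le _ _).trans (Finset.sum_le_sum fun a _ => ?_)
    rw [norm_mul]
    exact mul_le_of_le_one_right (norm_nonneg _)
      (CompactGroup.norm_unitarize_apply_le_one π hπ _ _ _)
  · intro U V hUV
    refine Finset.sum_congr rfl fun a ha => ?_
    have hP : ∀ e, IsOPosEdge e → U e = V e := fun e he => hUV e (by simp [he])
    have hC : ∀ e, IsLowerCross e → U e = V e := fun e he => hUV e (by simp [he])
    obtain ⟨hc0, hcR⟩ := isLowerCross_foot (L := L) j hj R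
    simp only [linkWord, hC _ hc0, hC _ hcR, linkStaple_congr j R a fun e he =>
      hP e (isOPosEdge_of_isPosEdge (isPosEdge_of_isLinkStapleEdge hj (hS a ha) he)).1]
  · refine Finset.measurable_sum _ fun a _ => Finset.measurable_sum _ fun b _ => ?_
    exact (entryMeasurable_rectangleHolonomy π hπ _ _ _ _ _).measurable_trace.const_mul _
  · intro U Y
    have hL' : (∑ a ∈ S, ∑ b ∈ S, (c a * c b : ℂ) *
        (σ (rectangleHolonomy (translateLow Y U) (tBase b) 0 j (a + b + 1) R)).trace) =
        ∑ a ∈ S, ∑ b ∈ S, ∑ i, ∑ l, (c a * c b : ℂ) *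
          (σ (linkWord j R a (LatticeRP.splice lowerEdges (U, Y))) i l *
            conj (σ (linkWord j R b U.timeReflect) i l)) := by
      refine Finset.sum_congr rfl fun a ha => Finset.sum_congr rfl fun b hb => ?_
      rw [trace_rectangleHolonomy_translateLow π hπ hj (hS a ha) (hS b hb) U Y, Finset.mul_sum]
      refine Finset.sum_congr rfl fun i _ => ?_
      rw [Finset.mul_sum]
    rw [hL', Fintype.sum_prod_type]
    simp only [map_sum, map_mul, Complex.conj_ofReal]
    rw [sum_sum_mul_sum_sum_rep]
    refine Finset.sum_congr rfl fun a _ => Finset.sum_congr rfl fun b _ =>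
      Finset.sum_congr rfl fun i _ => Finset.sum_congr rfl fun l _ => by ring

/-! ## §2 Site hyperplane: Gram positivity for `π`-rectangles of even height on the odd torus (real part of the complex form) -/

/-- **Gram positivity for `π`-rectangles bisected by the site hyperplane of the odd torus** (real part of the complex form): for `L` odd,
`L ≥ 3`, `β ≥ 0`, heights `a ≤ L/2` and real coefficients, `0 ≤ Re ⟨∑_{a,b} c_a c_b tr σ_π(W_{(a+b) × R} based at (τ − a, 0⃗))⟩_{Λ_L,β}`
(`wilsonExpectation_oddReflectionPositive` applied to the hanging `π`-staples). -/
theorem re_wilsonExpectation_gramRep_hang_nonneg_odd (hL : Odd L) (hL3 : 3 ≤ L) (hρ : Continuous ρ)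
    {β : ℝ} (hβ : 0 ≤ β) (hπ : Continuous π) {j : Fin d} (hj : j ≠ 0) (R : ℕ) (S : Finset ℕ)
    (hS : ∀ a ∈ S, a ≤ L / 2) (c : ℕ → ℝ) :
    0 ≤ (wilsonExpectation ρ β fun U : GaugeConfig d L G => ∑ a ∈ S, ∑ b ∈ S, (c a * c b : ℂ) *
      (CompactGroup.unitarize π hπ (rectangleHolonomy U (hangBase a) 0 j (a + b) R)).trace).re := by
  set σ := CompactGroup.unitarize π hπ with hσdef
  haveI := isProbabilityMeasure_wilsonMeasure (d := d) (L := L) ρ hρ β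
  set F : Fin M × Fin M → GaugeConfig d L G → ℂ :=
    fun il V => ∑ a ∈ S, (c a : ℂ) * conj (σ (hangStaple j R a V) il.1 il.2) with hFdef
  have hFm : ∀ il, Measurable (F il) := fun il =>
    Finset.measurable_sum _ fun a _ =>
      (Complex.continuous_conj.measurable.comp (entryMeasurable_hangStaple π hπ j R a il.1 il.2)).const_mul _
  have hFb : ∀ il V, ‖F il V‖ ≤ ∑ a ∈ S, ‖(c a : ℂ)‖ := fun il V => by
    refine (norm_sum_le _ _).trans (Finset.sum_le_sum fun a _ => ?_)
    rw [norm_mul, Complex.norm_conj]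
    exact mul_le_of_le_one_right (norm_nonneg _)
      (CompactGroup.norm_unitarize_apply_le_one π hπ _ _ _)
  have hFdep : ∀ il, DependsOn (F il)
      ((oPosEdges ∪ oSharedEdges : Finset (Edge d L)) : Set (Edge d L)) := by
    intro il U V hUV
    refine Finset.sum_congr rfl fun a ha => ?_
    have h : ∀ e, IsOPosEdge e ∨ IsOSharedEdge e → U e = V e := fun e he => hUV e (by
      rcases he with he | he <;> simp [he])
    simp only [hangStaple_congr j R a fun e he =>
      h e (isOPosEdge_or_isOSharedEdge_of_isHangStapleEdge hL hj (hS a ha) he)]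
  have hpos : ∀ il, 0 ≤ wilsonExpectation ρ β fun U => conj (F il U.timeReflect) * F il U := fun il =>
    wilsonExpectation_oddReflectionPositive ρ hL hL3 hρ hβ (F il) (hFm il) ⟨_, hFb il⟩ (hFdep il)
  -- the pointwise identity `∑_{il} conj F_{il}(ΘU) F_{il}(U) = Φ(U)`
  have hpt : ∀ U : GaugeConfig d L G, (∑ il : Fin M × Fin M, conj (F il U.timeReflect) * F il U) =
      ∑ a ∈ S, ∑ b ∈ S, (c a * c b : ℂ) *
        (σ (rectangleHolonomy U (hangBase a) 0 j (a + b) R)).trace := by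
    intro U
    have hR : ∀ a b, (σ (rectangleHolonomy U (hangBase a) 0 j (a + b) R)).trace =
        ∑ i, ∑ l, σ (hangStaple j R b U.timeReflect) i l * conj (σ (hangStaple j R a U) i l) := by
      intro a b
      rw [rectangleHolonomy_eq_hang U j, CompactGroup.trace_conj_eq, ← hangStaple_timeReflect hL U hj,
        trace_unitarize_mul_inv π hπ]
    simp_rw [hR]
    rw [Fintype.sum_prod_type]
    simp only [hFdef, map_sum, map_mul, Complex.conj_ofReal, Complex.conj_conj]
    have h2 : ∀ a b, (c a * c b : ℂ) * ∑ i, ∑ l, σ (hangStaple j R b U.timeReflect) i l *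
        conj (σ (hangStaple j R a U) i l) =
        ∑ i, ∑ l, (c a * c b : ℂ) * (σ (hangStaple j R b U.timeReflect) i l *
          conj (σ (hangStaple j R a U) i l)) := by
      intro a b
      rw [Finset.mul_sum]
      refine Finset.sum_congr rfl fun i _ => ?_
      rw [Finset.mul_sum]
    simp_rw [h2]
    rw [show (∑ i : Fin M, ∑ l : Fin M, (∑ b ∈ S, (c b : ℂ) * σ (hangStaple j R b U.timeReflect) i l) *
        ∑ a ∈ S, (c a : ℂ) * conj (σ (hangStaple j R a U) i l)) =
        ∑ i : Fin M, ∑ l : Fin M, (∑ a ∈ S, (c a : ℂ) * conj (σ (hangStaple j R a U) i l)) *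
          ∑ b ∈ S, (c b : ℂ) * σ (hangStaple j R b U.timeReflect) i l from
      Finset.sum_congr rfl fun i _ => Finset.sum_congr rfl fun l _ => mul_comm _ _,
      sum_sum_mul_sum_sum_rep]
    refine Finset.sum_congr rfl fun a _ => Finset.sum_congr rfl fun b _ =>
      Finset.sum_congr rfl fun i _ => Finset.sum_congr rfl fun l _ => by ring
  -- linearity
  have hint : ∀ il, Integrable (fun U : GaugeConfig d L G => conj (F il U.timeReflect) * F il U)
      (wilsonMeasure ρ β) := fun il =>
    Integrable.of_bound
      ((Complex.continuous_conj.measurable.comp ((hFm il).comp measurable_timeReflect)).mul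
        (hFm il)).aestronglyMeasurable ((∑ a ∈ S, ‖(c a : ℂ)‖) * ∑ a ∈ S, ‖(c a : ℂ)‖)
      (ae_of_all _ fun U => by
        rw [norm_mul, Complex.norm_conj]
        exact mul_le_mul (hFb _ _) (hFb _ _) (norm_nonneg _)
          ((norm_nonneg _).trans (hFb il U)))
  have hsum : wilsonExpectation ρ β (fun U : GaugeConfig d L G => ∑ a ∈ S, ∑ b ∈ S,
      (c a * c b : ℂ) * (σ (rectangleHolonomy U (hangBase a) 0 j (a + b) R)).trace) =
      ∑ il : Fin M × Fin M, wilsonExpectation ρ β fun U => conj (F il U.timeReflect) * F il U := by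
    unfold wilsonExpectation
    rw [← integral_finsetSum _ fun il _ => hint il]
    exact integral_congr_ae (ae_of_all _ fun U => (hpt U).symm)
  rw [hsum]
  exact (Complex.nonneg_iff.1 (Finset.sum_nonneg fun il _ => hpos il)).1

/-! ## §3 From complex Gram positivity to the real `π`-loop expectations -/

omit [NeZero d] [Fact (1 < L)] in
/-- `π`-loop expectations under the `ρ`-state do not depend on the base point (translation invariance of the torus Wilson state). -/
theorem wilsonExpectation_wilsonLoopRep_base (β : ℝ) (x : Site d L) (i j : Fin d) (R T : ℕ) :
    wilsonExpectation ρ β (wilsonLoop π x i j R T) =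
      wilsonExpectation ρ β (wilsonLoop π (0 : Site d L) i j R T) := by
  rw [← wilsonExpectation_comp_torusConfigShift ρ β (-x) (wilsonLoop π (0 : Site d L) i j R T)]
  congr 1
  funext U
  simp only [Function.comp_apply, wilsonLoop, WilsonLoopRP.rectangleHolonomy_torusConfigShift, zero_sub, neg_neg]

omit [Fact (1 < L)] in
/-- The real part of a Gram expectation of unitarised `π`-loop traces (general base points) is the Gram sum of the real `π`-loop expectations at
the origin (linearity, `Re tr σ_π = Re tr π`, translation to the base point `0`). -/
theorem re_wilsonExpectation_gramRep_base (hρ : Continuous ρ) (hπ : Continuous π) (hM : M ≠ 0) (β : ℝ) (j : Fin d)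
    (R : ℕ) (x : ℕ → ℕ → Site d L) (h : ℕ → ℕ → ℕ) (S : Finset ℕ) (c : ℕ → ℝ) :
    (wilsonExpectation ρ β fun U : GaugeConfig d L G => ∑ a ∈ S, ∑ b ∈ S, (c a * c b : ℂ) *
      (CompactGroup.unitarize π hπ (rectangleHolonomy U (x a b) 0 j (h a b) R)).trace).re =
      M * ∑ a ∈ S, ∑ b ∈ S, c a * c b *
        wilsonExpectation ρ β (wilsonLoop π (0 : Site d L) 0 j (h a b) R) := by
  set σ := CompactGroup.unitarize π hπ with hσdef
  haveI := isProbabilityMeasure_wilsonMeasure (d := d) (L := L) ρ hρ β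
  have htm : ∀ a b, Measurable fun U : GaugeConfig d L G =>
      (σ (rectangleHolonomy U (x a b) 0 j (h a b) R)).trace := fun a b =>
    (entryMeasurable_rectangleHolonomy π hπ _ _ _ _ _).measurable_trace
  have htb : ∀ a b (U : GaugeConfig d L G),
      ‖(σ (rectangleHolonomy U (x a b) 0 j (h a b) R)).trace‖ ≤ M := fun a b U => by
    rw [Matrix.trace]
    refine (norm_sum_le _ _).trans ?_
    calc ∑ k, ‖Matrix.diag (σ (rectangleHolonomy U (x a b) 0 j (h a b) R)) k‖
        ≤ ∑ _k : Fin M, (1 : ℝ) := Finset.sum_le_sum fun k _ =>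
          CompactGroup.norm_unitarize_apply_le_one π hπ _ k k
      _ = M := by simp
  have hint : ∀ a b, Integrable (fun U : GaugeConfig d L G =>
      (c a * c b : ℂ) * (σ (rectangleHolonomy U (x a b) 0 j (h a b) R)).trace)
      (wilsonMeasure ρ β) := fun a b =>
    (Integrable.of_bound (μ := wilsonMeasure ρ β) (htm a b).aestronglyMeasurable _
      (ae_of_all _ (htb a b))).const_mul _
  unfold wilsonExpectation
  rw [integral_finsetSum _ fun a _ => integrable_finsetSum _ fun b _ => hint a b, Complex.re_sum,
    Finset.mul_sum]
  refine Finset.sum_congr rfl fun a _ => ?_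
  rw [integral_finsetSum _ fun b _ => hint a b, Complex.re_sum, Finset.mul_sum]
  refine Finset.sum_congr rfl fun b _ => ?_
  have hre : (∫ U : GaugeConfig d L G,
      (σ (rectangleHolonomy U (x a b) 0 j (h a b) R)).trace ∂wilsonMeasure ρ β).re =
      ∫ U : GaugeConfig d L G,
        ((σ (rectangleHolonomy U (x a b) 0 j (h a b) R)).trace).re ∂wilsonMeasure ρ β := by
    have := integral_re (Integrable.of_bound (μ := wilsonMeasure ρ β) (htm a b).aestronglyMeasurable _
      (ae_of_all _ (htb a b)))
    simpa only [RCLike.re_to_complex] using this.symm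
  have hI : ∫ U : GaugeConfig d L G,
      ((σ (rectangleHolonomy U (x a b) 0 j (h a b) R)).trace).re ∂wilsonMeasure ρ β =
      M * ∫ U : GaugeConfig d L G, wilsonLoop π (x a b) 0 j (h a b) R U ∂wilsonMeasure ρ β := by
    rw [← integral_const_mul]
    refine integral_congr_ae (ae_of_all _ fun U => ?_)
    simp only [hσdef, CompactGroup.trace_unitarize, re_trace_eq_mul_wilsonLoop π hM]
  have hW := wilsonExpectation_wilsonLoopRep_base ρ π β (x a b) 0 j (h a b) R
  unfold wilsonExpectation at hW
  rw [integral_const_mul, ← Complex.ofReal_mul, Complex.re_ofReal_mul, hre, hI, ← hW]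
  ring

/-- **Gram inequality for `π`-loops of odd height on the odd torus** (with the `Fact (1 < L)` instance): `L` odd, `L ≥ 3`, `β ≥ 0`,
continuous `ρ` and `π`, `j ≠ 0`, heights `a + 1 ≤ L/2`, real coefficients: `0 ≤ ∑_{a,b} c_a c_b ⟨W^π_{(a+b+1)×R}⟩_{Λ_L,β}`. -/
theorem gram_wilsonLoopRep_nonneg_link_odd (hL : Odd L) (hL3 : 3 ≤ L) (hρ : Continuous ρ) {β : ℝ} (hβ : 0 ≤ β)
    (hπ : Continuous π) {j : Fin d} (hj : j ≠ 0) (R : ℕ) (S : Finset ℕ) (hS : ∀ a ∈ S, a + 1 ≤ L / 2) (c : ℕ → ℝ) :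
    0 ≤ ∑ a ∈ S, ∑ b ∈ S, c a * c b *
      wilsonExpectation ρ β (wilsonLoop π (0 : Site d L) 0 j (a + b + 1) R) := by
  rcases Nat.eq_zero_or_pos M with hM | hM
  · subst hM
    simp [wilsonLoop, wilsonExpectation]
  have h := (Complex.nonneg_iff.1
    (wilsonExpectation_gramRep_link_nonneg_odd ρ π hL hL3 hρ hβ hπ hj R S hS c)).1
  rw [re_wilsonExpectation_gramRep_base ρ π hρ hπ hM.ne' β j R (fun _ b => tBase b) (fun a b => a + b + 1) S c]
    at h
  exact nonneg_of_mul_nonneg_right h (Nat.cast_pos.2 hM)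

/-- **Gram inequality for `π`-loops of even height on the odd torus** (with the `Fact (1 < L)` instance): `L` odd, `L ≥ 3`, `β ≥ 0`,
continuous `ρ` and `π`, `j ≠ 0`, heights `a ≤ L/2`, real coefficients: `0 ≤ ∑_{a,b} c_a c_b ⟨W^π_{(a+b)×R}⟩_{Λ_L,β}`. -/
theorem gram_wilsonLoopRep_nonneg_site_odd (hL : Odd L) (hL3 : 3 ≤ L) (hρ : Continuous ρ) {β : ℝ} (hβ : 0 ≤ β)
    (hπ : Continuous π) {j : Fin d} (hj : j ≠ 0) (R : ℕ) (S : Finset ℕ) (hS : ∀ a ∈ S, a ≤ L / 2) (c : ℕ → ℝ) :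
    0 ≤ ∑ a ∈ S, ∑ b ∈ S, c a * c b *
      wilsonExpectation ρ β (wilsonLoop π (0 : Site d L) 0 j (a + b) R) := by
  rcases Nat.eq_zero_or_pos M with hM | hM
  · subst hM
    simp [wilsonLoop, wilsonExpectation]
  have h := re_wilsonExpectation_gramRep_hang_nonneg_odd ρ π hL hL3 hρ hβ hπ hj R S hS c
  rw [re_wilsonExpectation_gramRep_base ρ π hρ hπ hM.ne' β j R (fun a _ => hangBase a) (fun a b => a + b) S c]
    at h
  exact nonneg_of_mul_nonneg_right h (Nat.cast_pos.2 hM)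

end Gram

/-! ## §4 The torus theorems without the `Fact (1 < L)` instance -/

section Main

variable {d L N M : ℕ} {G : Type*} [Group G] [TopologicalSpace G] [IsTopologicalGroup G]
  [CompactSpace G] [MeasurableSpace G] [BorelSpace G]
  (ρ : G →* Matrix (Fin N) (Fin N) ℂ) (π : G →* Matrix (Fin M) (Fin M) ℂ)

/-- **Gram inequality for `π`-loops of odd height on the ODD torus**: for `L` odd, `L ≥ 3`, `β ≥ 0`, continuous `ρ` (action) and `π` (loop),
`j ≠ 0`, heights `a + 1 ≤ L/2` and real coefficients, `0 ≤ ∑_{a,b ∈ S} c_a c_b ⟨W^π_{(a+b+1) × R}⟩_{Λ_L,β}` (reflection positivity in the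
hyperplane between time slices of the odd torus). -/
theorem gram_wilsonLoopRep_nonneg_odd_of_odd [NeZero d] [NeZero L] (hL : Odd L) (hL3 : 3 ≤ L)
    (hρ : Continuous ρ) {β : ℝ} (hβ : 0 ≤ β) (hπ : Continuous π) {j : Fin d} (hj : j ≠ 0) (R : ℕ) (S : Finset ℕ)
    (hS : ∀ a ∈ S, a + 1 ≤ L / 2) (c : ℕ → ℝ) :
    0 ≤ ∑ a ∈ S, ∑ b ∈ S, c a * c b *
      wilsonExpectation ρ β (wilsonLoop π (0 : Site d L) 0 j (a + b + 1) R) := by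
  haveI : Fact (1 < L) := ⟨by omega⟩
  exact gram_wilsonLoopRep_nonneg_link_odd ρ π hL hL3 hρ hβ hπ hj R S hS c

/-- **Gram inequality for `π`-loops of even height on the ODD torus**: for `L` odd, `L ≥ 3`, `β ≥ 0`, continuous `ρ` and `π`, `j ≠ 0`,
heights `a ≤ L/2` and real coefficients, `0 ≤ ∑_{a,b ∈ S} c_a c_b ⟨W^π_{(a+b) × R}⟩_{Λ_L,β}` (reflection positivity in the site hyperplane
`t = (L+1)/2` of the odd torus). -/
theorem gram_wilsonLoopRep_nonneg_even_of_odd [NeZero d] [NeZero L] (hL : Odd L) (hL3 : 3 ≤ L)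
    (hρ : Continuous ρ) {β : ℝ} (hβ : 0 ≤ β) (hπ : Continuous π) {j : Fin d} (hj : j ≠ 0) (R : ℕ) (S : Finset ℕ)
    (hS : ∀ a ∈ S, a ≤ L / 2) (c : ℕ → ℝ) :
    0 ≤ ∑ a ∈ S, ∑ b ∈ S, c a * c b *
      wilsonExpectation ρ β (wilsonLoop π (0 : Site d L) 0 j (a + b) R) := by
  haveI : Fact (1 < L) := ⟨by omega⟩
  exact gram_wilsonLoopRep_nonneg_site_odd ρ π hL hL3 hρ hβ hπ hj R S hS c

end Main

end Summit.QuantumFields.YangMills.Cruxes.IR.OddTorusRP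

end
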